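import Summits.ResolutionOfSingularities.ResolutionOfSingularities.Theorems.HilbertSamuelEliminationSigmaMaxModificationsCorridor3WLadderIsoTailsHSArcCompletion
import HarnessLib

/-!
# [OURS · L1 W4.2] D14 ROUTE G v2 — G2f bookkeeping: the FORMAL MODEL of a stage through the base frame, for a GENERAL kernel:
# `S ⧸ ψ₀(ker σ)·S ≃ 𝒪̂` (Matsumura Thm. 8.11 «completion commutes with quotients» through the Cohen coordinates `Ψ`)

Cell res-hironaka, rung L, slot W4.2 (crux `SigmaMaxModifications`, stmt-ResolutionOfSingularities-19249), kernel K1, ROUTE G v2 «ARC LIMIT»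
(res-L1-w42-lead-1 ROUTE-G-ARCLIMIT §1: «`J_n := ψ_n(ker σ_n)·S` … `S/J_n ≃ 𝒪̂_{X_n,x_n}`»; RULING v3.14-20 (FO) «G2f := 001»). The hypersurface
versions (kernel `(h)`) are res-type-001's `IsoTailsHS.nonempty_ringEquiv_adicCompletion_quotient_span` (p525298) and lead-1's
`FormalFrame.exists_completionEquiv_of_presentation` (p529195); this file removes «principal»:

* `nonempty_ringEquiv_adicCompletion_quotient_map` — `R` Noetherian local, `I` any ideal with `R ⧸ I` local, `A` local with
  `e : A ≃+* R ⧸ I`: `Â ≃+* R̂ ⧸ I R̂`.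
* `nonempty_ringEquiv_adicCompletion_quotient_map_of_surjective` — the same from a surjection `σ : R ↠ A` (`I = ker σ`).
* **`nonempty_frameModelEquiv_of_surjective`** — with Cohen coordinates `Ψ : S ≃+* R̂` and a base frame `ψ₀ : R →+* S`,
  `Ψ ∘ ψ₀ = (R → R̂)` (res-type-038's `exists_baseFrame_of_rsop`): `Â ≃+* S ⧸ (ker σ).map ψ₀` — the `e′` of
  `IsoTailsHS.false_of_isIsoPointTower_of_stage_of_bennettArc` (`…IsoTailsBennettArcHyp`) — and `IsLocalRing (S ⧸ (ker σ).map ψ₀)`.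
* rev 2 `nonempty_frameModelEquiv_map_of_surjective` — the same for the SHEARED ideal `θ(J)`, any automorphism `θ : S ≃+* S`.

[OURS · L1 W4.2] AI-written (res-type-001 g8); AI review is weaker than expert review. NOT a statement of any source nor of H. Hironaka's
2017 manuscript.
-/

set_option linter.dupNamespace false

noncomputable section

open IsLocalRing
open Literature.AlgebraicGeometry.Resolution Literature.RingTheory.HilbertSamuel

namespace Summit.ResolutionOfSingularities.ResolutionOfSingularities.Theorems.SigmaMaxModificationsCorridor3.IsoTailsHS

universe u

/-- **Completion commutes with quotients, transported**: `R` Noetherian local, `I` an ideal with `R ⧸ I` local, `A` local with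
`e : A ≃+* R ⧸ I` ⟹ `Â ≃+* R̂ ⧸ I R̂` (`𝔪`-adic completions). [cite: Matsumura1987, Thm. 8.11] -/
theorem nonempty_ringEquiv_adicCompletion_quotient_map {R : Type u} [CommRing R] [IsLocalRing R] [IsNoetherianRing R]
    {A : Type u} [CommRing A] [IsLocalRing A] (I : Ideal R) [IsLocalRing (R ⧸ I)] (e : A ≃+* R ⧸ I) :
    Nonempty (AdicCompletion (maximalIdeal A) A ≃+*
      AdicCompletion (maximalIdeal R) R ⧸ I.map (algebraMap R (AdicCompletion (maximalIdeal R) R))) := by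
  let E₁ : AdicCompletion (maximalIdeal A) A ≃+* AdicCompletion (maximalIdeal (R ⧸ I)) (R ⧸ I) :=
    adicCompletionCongr _ _ e (map_ringEquiv_maximalIdeal e)
  have hm : (maximalIdeal R).map (Ideal.Quotient.mk I) = maximalIdeal (R ⧸ I) :=
    IsLocalRing.map_maximalIdeal_of_surjective _ Ideal.Quotient.mk_surjective
  let E₂ : AdicCompletion (maximalIdeal (R ⧸ I)) (R ⧸ I) ≃+* AdicCompletion ((maximalIdeal R).map (Ideal.Quotient.mk I)) (R ⧸ I) :=
    adicCompletionCongr _ _ (RingEquiv.refl _) (by rw [hm]; exact Ideal.map_id _)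
  exact ⟨(E₁.trans E₂).trans (quotientCompletionEquiv (maximalIdeal R) I).symm⟩

/-- The same from a surjection `σ : R ↠ A` with kernel `I = ker σ`. [cite: Matsumura1987, Thm. 8.11] -/
theorem nonempty_ringEquiv_adicCompletion_quotient_map_of_surjective {R : Type u} [CommRing R] [IsLocalRing R]
    [IsNoetherianRing R] {A : Type u} [CommRing A] [IsLocalRing A] (σ : R →+* A) (hσ : Function.Surjective σ) :
    Nonempty (AdicCompletion (maximalIdeal A) A ≃+*
      AdicCompletion (maximalIdeal R) R ⧸ (RingHom.ker σ).map (algebraMap R (AdicCompletion (maximalIdeal R) R))) := by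
  let e : A ≃+* R ⧸ RingHom.ker σ := (RingHom.quotientKerEquivOfSurjective hσ).symm
  haveI : IsLocalRing (R ⧸ RingHom.ker σ) := e.isLocalRing
  exact nonempty_ringEquiv_adicCompletion_quotient_map (RingHom.ker σ) e

/-- **THE FORMAL MODEL OF A STAGE THROUGH THE BASE FRAME (general kernel).** `R` Noetherian local with Cohen coordinates
`Ψ : S ≃+* R̂` and base frame `ψ₀ : R →+* S`, `Ψ (ψ₀ r) = r` in `R̂` (res-type-038's `exists_baseFrame_of_rsop`); `σ : R ↠ A` a presentation
of a local ring. Then `J := (ker σ).map ψ₀` satisfies `S ⧸ J ≃+* Â` — the formal model `e′` consumed by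
`false_of_isIsoPointTower_of_stage_of_bennettArc` — and `S ⧸ J` is local. [cite: Matsumura1987, Thm. 8.11] -/
theorem nonempty_frameModelEquiv_of_surjective {R : Type u} [CommRing R] [IsLocalRing R] [IsNoetherianRing R]
    {S : Type u} [CommRing S] (Ψ : S ≃+* AdicCompletion (maximalIdeal R) R) (ψ₀ : R →+* S)
    (hΨψ₀ : ∀ r, Ψ (ψ₀ r) = algebraMap R (AdicCompletion (maximalIdeal R) R) r)
    {A : Type u} [CommRing A] [IsLocalRing A] [IsNoetherianRing A] (σ : R →+* A) (hσ : Function.Surjective σ) :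
    IsLocalRing (S ⧸ (RingHom.ker σ).map ψ₀) ∧
      Nonempty ((S ⧸ (RingHom.ker σ).map ψ₀) ≃+* AdicCompletion (maximalIdeal A) A) := by
  obtain ⟨E⟩ := nonempty_ringEquiv_adicCompletion_quotient_map_of_surjective σ hσ
  -- `R̂ ⧸ I R̂ ≃ S ⧸ ψ₀(I) S` along `Ψ⁻¹`
  have hJ : (RingHom.ker σ).map ψ₀ =
      ((RingHom.ker σ).map (algebraMap R (AdicCompletion (maximalIdeal R) R))).map (Ψ.symm : _ →+* S) := by
    rw [Ideal.map_map]
    congr 1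
    ext r
    simp only [RingHom.comp_apply, RingHom.coe_coe]
    rw [← hΨψ₀, RingEquiv.symm_apply_apply]
  let E' : (AdicCompletion (maximalIdeal R) R ⧸ (RingHom.ker σ).map (algebraMap R (AdicCompletion (maximalIdeal R) R))) ≃+*
      S ⧸ (RingHom.ker σ).map ψ₀ :=
    Ideal.quotientEquiv _ _ Ψ.symm hJ
  let e' : (S ⧸ (RingHom.ker σ).map ψ₀) ≃+* AdicCompletion (maximalIdeal A) A := (E.trans E').symm
  exact ⟨e'.symm.isLocalRing, ⟨e'⟩⟩

/-! ## rev 2 — the model in SHEARED coordinates (any automorphism `θ` of `S`, e.g. lead-1's shear `ỹ_i = y_i − a_i(t)`,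
`Series.shearSubst`): `S ⧸ θ(J) ≃ Â` as well -/

/-- **The formal model after a change of formal coordinates.** For any ring automorphism `θ : S ≃+* S` (the shear of
ROUTE-G-ARCLIMIT §1 / G2b), the sheared ideal `J′ = θ(J)`, `J = (ker σ).map ψ₀`, still presents the completion: `S ⧸ J′` is local and
`S ⧸ J′ ≃+* Â` (`Ideal.quotientEquiv` along `θ`). This is the `e′` of `false_of_isIsoPointTower_of_stage_of_bennettArc` when G2c is read
in sheared coordinates (arc prime `P₀ = (X_1, …, X_d)`). [cite: Matsumura1987, Thm. 8.11] -/
theorem nonempty_frameModelEquiv_map_of_surjective {R : Type u} [CommRing R] [IsLocalRing R] [IsNoetherianRing R]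
    {S : Type u} [CommRing S] (Ψ : S ≃+* AdicCompletion (maximalIdeal R) R) (ψ₀ : R →+* S)
    (hΨψ₀ : ∀ r, Ψ (ψ₀ r) = algebraMap R (AdicCompletion (maximalIdeal R) R) r)
    {A : Type u} [CommRing A] [IsLocalRing A] [IsNoetherianRing A] (σ : R →+* A) (hσ : Function.Surjective σ) (θ : S ≃+* S) :
    IsLocalRing (S ⧸ ((RingHom.ker σ).map ψ₀).map (θ : S →+* S)) ∧
      Nonempty ((S ⧸ ((RingHom.ker σ).map ψ₀).map (θ : S →+* S)) ≃+* AdicCompletion (maximalIdeal A) A) := by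
  obtain ⟨_, ⟨e⟩⟩ := nonempty_frameModelEquiv_of_surjective Ψ ψ₀ hΨψ₀ σ hσ
  let eθ : (S ⧸ (RingHom.ker σ).map ψ₀) ≃+* S ⧸ ((RingHom.ker σ).map ψ₀).map (θ : S →+* S) :=
    Ideal.quotientEquiv _ _ θ rfl
  exact ⟨eθ.isLocalRing, ⟨eθ.symm.trans e⟩⟩

end Summit.ResolutionOfSingularities.ResolutionOfSingularities.Theorems.SigmaMaxModificationsCorridor3.IsoTailsHS

end
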